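import Summits.QuantumFields.YangMills.Theorems.UnitScaleTiltProp7TransplantGen0Package
import HarnessLib

/-!
# Route `UnitScaleTilt`, crux K1 «MinimiserStabilityRegPr» (stmt-QuantumFields-19200), route-R E′ path (α′), (E1-b) at the CURVED background — (A-cov) gen-0, FILE «GEN-0 ARITHMETIC»:
# THE `ℓ`-BOOKKEEPING OF THE FIVE gen-0 NUMBERS OF ✓ `exists_gen0_package` — under the cone-letter sizes `A₁ℓ² ≤ α`, `A₀ℓ² ≤ α`, `A₂ℓ³ ≤ α`, the weight count `W₀ ≤ w·ℓ√ℓ`, the Poincaré constant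
# `A ≤ c_A·ℓ²`, `‖X‖ ≤ √hs X` and `#S ≤ (2(9ℓ+1))³` (all as displayed real hypotheses), the gen-0 half of the door total is LINEAR in `ℓ = L^k`:
# `N2₀ + N3₀ + W₀·3N4₀ + W₀·(3H₀ + 5A·S₀) ≤ c₀·ℓ·√hs X`, `c₀ = C·(9737 + 24000√N(32α+400α²) + (10648 + 312wΩ)·K + 270wΩ(3√N(32α+400α²)+1) + 450·w·c_A·Ω)`, `K = 27c_d² + 3√N(26α + 484α² + 66c_dα)`

Cell `ym3-torus`, width seat `ym3-torus-px22` (gen 3).  Pure real arithmetic; the five left-hand expressions are the right-hand sides of ✓p681217 `exists_gen0_package` VERBATIM with `((L^k : ℕ) : ℝ) ↦ ℓ₁`,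
`(L : ℝ)^k ↦ ℓ` (`ℓ₁ = ℓ`), `P.d ↦ d = 3`, `√hs X ↦ rX`, `‖X‖ ↦ nX`, `#S ↦ card`, so the member file combines them by `ring`∕`linarith`.  THEOREMS ONLY (0 `def`, 0 `sorry`); `--supports stmt-QuantumFields-19200`,
count-neutral.  YM₃ on T³ is a ladder rung (R3), not the Clay problem; nothing here claims the stub, the crux, d = 4 or the gap.

WHAT IS PROVED (ns `…Theorems.Prop7TransplantGen0Arithmetic`).
* §1 letters `pow_three_le`, `sqrt_le_mul_sqrt`, `junk_B_le`, `junk_Bt_le`; §2 ★★★ `gen0_total_le`.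
HONEST SCOPE.  Bookkeeping; the member file and gen-1's numbers are the remaining inputs of `htot`.

References: T. Bałaban, CMP 96 (1984) 223–250 [Balaban1984PropagatorsII] ((1.9) p.226); CMP 99 (1985) 75–102 [Balaban1985RegularSpaces] ((1.36) p.82).
-/

set_option autoImplicit false

noncomputable section

namespace Summit.QuantumFields.YangMills.Theorems.Prop7TransplantGen0Arithmetic

/-! ## §1 Letters -/

/-- `(2(9ℓ+1))³ ≤ 8000ℓ³` and `(2(10ℓ+1))³ ≤ 10648ℓ³` for `ℓ ≥ 1`. [folklore] -/
theorem pow_three_le {ℓ : ℝ} (hℓ : 1 ≤ ℓ) : (2 * (9 * ℓ + 1)) ^ 3 ≤ 8000 * ℓ ^ 3 ∧ (2 * (9 * ℓ + ℓ + 1)) ^ 3 ≤ 10648 * ℓ ^ 3 := by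
  have h1 : 2 * (9 * ℓ + 1) ≤ 20 * ℓ := by linarith
  have h2 : 2 * (9 * ℓ + ℓ + 1) ≤ 22 * ℓ := by linarith
  have h1' : (2 * (9 * ℓ + 1)) ^ 3 ≤ (20 * ℓ) ^ 3 := pow_le_pow_left₀ (by linarith) h1 3
  have h2' : (2 * (9 * ℓ + ℓ + 1)) ^ 3 ≤ (22 * ℓ) ^ 3 := pow_le_pow_left₀ (by linarith) h2 3
  constructor <;> nlinarith

/-- `√(K·ℓ³) ≤ m·ℓ·√ℓ` when `K ≤ m²`, `0 ≤ m`, `0 ≤ ℓ`. [folklore] -/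
theorem sqrt_le_mul_sqrt {K m ℓ : ℝ} (hK : K ≤ m ^ 2) (hm : 0 ≤ m) (hℓ : 0 ≤ ℓ) : Real.sqrt (K * ℓ ^ 3) ≤ m * ℓ * Real.sqrt ℓ := by
  have hs : Real.sqrt ℓ ^ 2 = ℓ := Real.sq_sqrt hℓ
  have h0 : 0 ≤ m * ℓ * Real.sqrt ℓ := by positivity
  rw [← Real.sqrt_sq h0]
  refine Real.sqrt_le_sqrt ?_
  have e : (m * ℓ * Real.sqrt ℓ) ^ 2 = m ^ 2 * ℓ ^ 2 * Real.sqrt ℓ ^ 2 := by ring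
  rw [e, hs]
  nlinarith [pow_nonneg hℓ 3]

/-- **THE JUNK CONSTANT IS `≤ (32α + 400α²)C∕ℓ²`**: `B·ℓ² ≤ (32α + 400α²)·C` for `B = (2(A₀ + A₂(9ℓ+2)) + 4(A₁(9ℓ+1))²)C + 8A₁C`. [folklore] -/
theorem junk_B_le {ℓ C α A₀ A₁ A₂ : ℝ} (hℓ : 1 ≤ ℓ) (hC : 0 ≤ C) (hA₁0 : 0 ≤ A₁) (hA₂0 : 0 ≤ A₂)
    (hA₀ : A₀ * ℓ ^ 2 ≤ α) (hA₁ : A₁ * ℓ ^ 2 ≤ α) (hA₂ : A₂ * ℓ ^ 3 ≤ α) :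
    ((2 * (A₀ + A₂ * (9 * ℓ + 2)) + 4 * (A₁ * (9 * ℓ + 1)) ^ 2) * C + 8 * A₁ * C) * ℓ ^ 2 ≤ (32 * α + 400 * α ^ 2) * C := by
  have hα : 0 ≤ α := le_trans (by positivity) hA₁
  have h9 : A₂ * (9 * ℓ + 2) * ℓ ^ 2 ≤ 11 * α := by
    have : A₂ * (9 * ℓ + 2) ≤ A₂ * (11 * ℓ) := mul_le_mul_of_nonneg_left (by linarith) hA₂0
    nlinarith
  have h10 : (A₁ * (9 * ℓ + 1)) ^ 2 * ℓ ^ 2 ≤ 100 * α ^ 2 := by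
    have h' : A₁ * (9 * ℓ + 1) ≤ 10 * (A₁ * ℓ) := by nlinarith
    have h'' : (A₁ * (9 * ℓ + 1)) ^ 2 ≤ (10 * (A₁ * ℓ)) ^ 2 := pow_le_pow_left₀ (by positivity) h' 2
    have h3 : (10 * (A₁ * ℓ)) ^ 2 * ℓ ^ 2 = 100 * (A₁ * ℓ ^ 2) ^ 2 := by ring
    have h4 : (A₁ * ℓ ^ 2) ^ 2 ≤ α ^ 2 := pow_le_pow_left₀ (by positivity) hA₁ 2
    nlinarith [pow_nonneg (by positivity : (0 : ℝ) ≤ ℓ) 2]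
  have e : ((2 * (A₀ + A₂ * (9 * ℓ + 2)) + 4 * (A₁ * (9 * ℓ + 1)) ^ 2) * C + 8 * A₁ * C) * ℓ ^ 2
      = (2 * (A₀ * ℓ ^ 2) + 2 * (A₂ * (9 * ℓ + 2) * ℓ ^ 2) + 4 * ((A₁ * (9 * ℓ + 1)) ^ 2 * ℓ ^ 2) + 8 * (A₁ * ℓ ^ 2)) * C := by ring
  rw [e]
  exact mul_le_mul_of_nonneg_right (by nlinarith) hC

/-- **THE NEAR-DATUM CONSTANT**: with `τ₁ := A₁(10ℓ+1)`, `τ₂ := A₀ + A₂(10ℓ+2)`: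
`((2τ₂ + 4τ₁²)C + 4τ₁·(C·(3c_d∕(2ℓ))))·ℓ² ≤ (26α + 484α² + 66c_dα)·C`. [folklore] -/
theorem junk_Bt_le {ℓ C α cd A₀ A₁ A₂ : ℝ} (hℓ : 1 ≤ ℓ) (hC : 0 ≤ C) (hcd : 0 ≤ cd) (hA₁0 : 0 ≤ A₁) (hA₂0 : 0 ≤ A₂)
    (hA₀ : A₀ * ℓ ^ 2 ≤ α) (hA₁ : A₁ * ℓ ^ 2 ≤ α) (hA₂ : A₂ * ℓ ^ 3 ≤ α) :
    ((2 * (A₀ + A₂ * (9 * ℓ + ℓ + 2)) + 4 * (A₁ * (9 * ℓ + ℓ + 1)) ^ 2) * C + 4 * (A₁ * (9 * ℓ + ℓ + 1)) * (C * (3 * cd / (2 * ℓ)))) * ℓ ^ 2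
      ≤ (26 * α + 484 * α ^ 2 + 66 * cd * α) * C := by
  have hℓ0 : 0 < ℓ := by linarith
  have hα : 0 ≤ α := le_trans (by positivity) hA₁
  have h12 : A₂ * (9 * ℓ + ℓ + 2) * ℓ ^ 2 ≤ 12 * α := by
    have : A₂ * (9 * ℓ + ℓ + 2) ≤ A₂ * (12 * ℓ) := mul_le_mul_of_nonneg_left (by linarith) hA₂0
    nlinarith
  have h11 : (A₁ * (9 * ℓ + ℓ + 1)) ^ 2 * ℓ ^ 2 ≤ 121 * α ^ 2 := by
    have h' : A₁ * (9 * ℓ + ℓ + 1) ≤ 11 * (A₁ * ℓ) := by nlinarith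
    have h'' : (A₁ * (9 * ℓ + ℓ + 1)) ^ 2 ≤ (11 * (A₁ * ℓ)) ^ 2 := pow_le_pow_left₀ (by positivity) h' 2
    have h3 : (11 * (A₁ * ℓ)) ^ 2 * ℓ ^ 2 = 121 * (A₁ * ℓ ^ 2) ^ 2 := by ring
    have h4 : (A₁ * ℓ ^ 2) ^ 2 ≤ α ^ 2 := pow_le_pow_left₀ (by positivity) hA₁ 2
    nlinarith [pow_nonneg hℓ0.le 2]
  have h66 : 4 * (A₁ * (9 * ℓ + ℓ + 1)) * (C * (3 * cd / (2 * ℓ))) * ℓ ^ 2 ≤ 66 * cd * α * C := by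
    have h' : A₁ * (9 * ℓ + ℓ + 1) ≤ 11 * (A₁ * ℓ) := by nlinarith
    have e : 4 * (A₁ * (9 * ℓ + ℓ + 1)) * (C * (3 * cd / (2 * ℓ))) * ℓ ^ 2 = 6 * cd * C * ((A₁ * (9 * ℓ + ℓ + 1)) * ℓ) := by
      field_simp
      ring
    rw [e]
    have h2 : (A₁ * (9 * ℓ + ℓ + 1)) * ℓ ≤ 11 * α := by nlinarith
    nlinarith [mul_nonneg hcd hC]
  have e : ((2 * (A₀ + A₂ * (9 * ℓ + ℓ + 2)) + 4 * (A₁ * (9 * ℓ + ℓ + 1)) ^ 2) * C + 4 * (A₁ * (9 * ℓ + ℓ + 1)) * (C * (3 * cd / (2 * ℓ)))) * ℓ ^ 2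
      = (2 * (A₀ * ℓ ^ 2) + 2 * (A₂ * (9 * ℓ + ℓ + 2) * ℓ ^ 2) + 4 * ((A₁ * (9 * ℓ + ℓ + 1)) ^ 2 * ℓ ^ 2)) * C
        + 4 * (A₁ * (9 * ℓ + ℓ + 1)) * (C * (3 * cd / (2 * ℓ))) * ℓ ^ 2 := by ring
  rw [e]
  have hfirst : (2 * (A₀ * ℓ ^ 2) + 2 * (A₂ * (9 * ℓ + ℓ + 2) * ℓ ^ 2) + 4 * ((A₁ * (9 * ℓ + ℓ + 1)) ^ 2 * ℓ ^ 2)) * C ≤ (26 * α + 484 * α ^ 2) * C :=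
    mul_le_mul_of_nonneg_right (by nlinarith) hC
  nlinarith

/-- **WEIGHT COUNT × BALL COUNT**: `W₀ ≤ w·ℓ·√ℓ`, `R ≤ m·ℓ·√ℓ` ⇒ `W₀·(Ω·R·X) ≤ w·m·Ω·ℓ·(X·ℓ²)` (`√ℓ·√ℓ = ℓ`). [folklore] -/
theorem weight_count_mul_le {W₀ w ℓ s Ω R m X : ℝ} (hW₀ : W₀ ≤ w * ℓ * s) (hw : 0 ≤ w) (hℓ : 0 ≤ ℓ) (hs : 0 ≤ s) (hΩ : 0 ≤ Ω)
    (hR0 : 0 ≤ R) (hR : R ≤ m * ℓ * s) (hX : 0 ≤ X) (hss : s * s = ℓ) :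
    W₀ * (Ω * R * X) ≤ w * m * Ω * ℓ * (X * ℓ ^ 2) := by
  have a1 : Ω * R * X ≤ Ω * (m * ℓ * s) * X := mul_le_mul_of_nonneg_right (mul_le_mul_of_nonneg_left hR hΩ) hX
  have a2 : W₀ * (Ω * R * X) ≤ (w * ℓ * s) * (Ω * (m * ℓ * s) * X) := mul_le_mul hW₀ a1 (by positivity) (by positivity)
  have e : (w * ℓ * s) * (Ω * (m * ℓ * s) * X) = w * m * Ω * (X * ℓ ^ 2) * (s * s) := by ring
  rw [e, hss] at a2
  have e2 : w * m * Ω * (X * ℓ ^ 2) * ℓ = w * m * Ω * ℓ * (X * ℓ ^ 2) := by ring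
  rw [e2] at a2
  exact a2

/-! ## §2 ★★★ The gen-0 half of the door total is linear in `ℓ` -/

set_option maxHeartbeats 400000 in
/-- ★★★ **THE gen-0 HALF OF `htot` IS `≤ c₀·ℓ·√hs X`** (see the module docstring; every power of `ℓ` cancels: `#S ≍ ℓ³`, `W₀ ≍ ℓ√ℓ`, `A ≍ ℓ²`, `H₀ ≍ ℓ^{−1∕2}`, `S₀ ≍ ℓ^{−5∕2}`).
[cite: Balaban1984PropagatorsII, (1.9) p.226; Balaban1985RegularSpaces, (1.36) p.82] -/
theorem gen0_total_le {d : ℕ} (hd : d = 3) (N : ℕ) {ℓ₁ ℓ : ℝ} (hℓ₁ : ℓ₁ = ℓ) (hℓ : 3 ≤ ℓ)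
    {C α Ω W₀ w A cA rX nX card A₀ A₁ A₂ : ℝ} (hC : 0 ≤ C) (hΩ : 0 ≤ Ω) (hw : 0 ≤ w) (hrX : 0 ≤ rX) (hnX0 : 0 ≤ nX) (hnX : nX ≤ rX)
    (hA₀0 : 0 ≤ A₀) (hA₁0 : 0 ≤ A₁) (hA₂0 : 0 ≤ A₂) (hA₀ : A₀ * ℓ ^ 2 ≤ α) (hA₁ : A₁ * ℓ ^ 2 ≤ α) (hA₂ : A₂ * ℓ ^ 3 ≤ α)
    (hW₀ : W₀ ≤ w * ℓ * Real.sqrt ℓ) (hA0 : 0 ≤ A) (hA : A ≤ cA * ℓ ^ 2) (hcard : card ≤ (2 * (9 * ℓ₁ + 1)) ^ d) :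
    -- N2₀
    (rX * (C * (9 + 192 * (9 * ℓ₁)) + (2 * (9 * ℓ₁ + 1)) ^ d * (C / ℓ₁ ^ 2))
      + Real.sqrt N * (nX * ((2 * (9 * ℓ₁ + 1)) ^ d * (d * ((2 * (A₀ + A₂ * (9 * ℓ₁ + 2)) + 4 * (A₁ * (9 * ℓ₁ + 1)) ^ 2) * C + 8 * A₁ * C)))))
    -- N3₀
    + (2 * (9 * ℓ₁ + ℓ + 1)) ^ d
        * (C * (9 * d * (10 * Real.sqrt d + 6) ^ 2 / ℓ ^ 2) * rX
          + Real.sqrt N * nX * (d * ((2 * (A₀ + A₂ * (9 * ℓ₁ + ℓ + 2)) + 4 * (A₁ * (9 * ℓ₁ + ℓ + 1)) ^ 2) * C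
            + 4 * (A₁ * (9 * ℓ₁ + ℓ + 1)) * (C * (3 * (10 * Real.sqrt d + 6) / (2 * ℓ))))))
    -- W₀·3·N4₀
    + W₀ * (3 * (Ω * Real.sqrt ((2 * (9 * ℓ₁ + ℓ + 1)) ^ d)
        * (C * (9 * d * (10 * Real.sqrt d + 6) ^ 2 / ℓ ^ 2) * rX
          + Real.sqrt N * nX * (d * ((2 * (A₀ + A₂ * (9 * ℓ₁ + ℓ + 2)) + 4 * (A₁ * (9 * ℓ₁ + ℓ + 1)) ^ 2) * C
            + 4 * (A₁ * (9 * ℓ₁ + ℓ + 1)) * (C * (3 * (10 * Real.sqrt d + 6) / (2 * ℓ))))))))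
    -- W₀·(3H₀ + 5A·S₀)
    + W₀ * (3 * (Ω * Real.sqrt card * (Real.sqrt N * (d * ((2 * (A₀ + A₂ * (9 * ℓ₁ + 2)) + 4 * (A₁ * (9 * ℓ₁ + 1)) ^ 2) * C + 8 * A₁ * C) * nX) + C / ℓ₁ ^ 2 * rX))
        + 5 * A * (Ω * Real.sqrt card * (C / ℓ₁ ^ 4 * rX)))
    ≤ C * (9737 + 24000 * Real.sqrt N * (32 * α + 400 * α ^ 2)
        + (10648 + 312 * w * Ω) * (27 * (10 * Real.sqrt 3 + 6) ^ 2 + 3 * Real.sqrt N * (26 * α + 484 * α ^ 2 + 66 * (10 * Real.sqrt 3 + 6) * α))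
        + 270 * w * Ω * (3 * Real.sqrt N * (32 * α + 400 * α ^ 2) + 1) + 450 * w * cA * Ω) * ℓ * rX := by
  subst hd; subst hℓ₁
  have hd3 : ((3 : ℕ) : ℝ) = 3 := by norm_num
  simp only [hd3]
  -- letters
  have hℓ1 : (1 : ℝ) ≤ ℓ₁ := by linarith
  have hℓ0 : (0 : ℝ) < ℓ₁ := by linarith
  set cd : ℝ := 10 * Real.sqrt 3 + 6 with hcd
  have hcd0 : 0 ≤ cd := by rw [hcd]; positivity
  set sN : ℝ := Real.sqrt N with hsN
  have hsN0 : 0 ≤ sN := Real.sqrt_nonneg _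
  set s : ℝ := Real.sqrt ℓ₁ with hs
  have hs0 : 0 ≤ s := Real.sqrt_nonneg _
  have hss : s * s = ℓ₁ := Real.mul_self_sqrt hℓ0.le
  have hα : 0 ≤ α := le_trans (by positivity) hA₁
  set B : ℝ := (2 * (A₀ + A₂ * (9 * ℓ₁ + 2)) + 4 * (A₁ * (9 * ℓ₁ + 1)) ^ 2) * C + 8 * A₁ * C with hBdef
  set Bt : ℝ := (2 * (A₀ + A₂ * (9 * ℓ₁ + ℓ₁ + 2)) + 4 * (A₁ * (9 * ℓ₁ + ℓ₁ + 1)) ^ 2) * C + 4 * (A₁ * (9 * ℓ₁ + ℓ₁ + 1)) * (C * (3 * cd / (2 * ℓ₁))) with hBtdef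
  have hB0 : 0 ≤ B := by rw [hBdef]; positivity
  have hBt0 : 0 ≤ Bt := by rw [hBtdef]; positivity
  have hB : B * ℓ₁ ^ 2 ≤ (32 * α + 400 * α ^ 2) * C := junk_B_le hℓ1 hC hA₁0 hA₂0 hA₀ hA₁ hA₂
  have hBt : Bt * ℓ₁ ^ 2 ≤ (26 * α + 484 * α ^ 2 + 66 * cd * α) * C := junk_Bt_le hℓ1 hC hcd0 hA₁0 hA₂0 hA₀ hA₁ hA₂
  obtain ⟨hP, hQ⟩ := pow_three_le hℓ1
  -- square roots of the counts
  have hsqcard : Real.sqrt card ≤ 90 * ℓ₁ * s := by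
    refine (Real.sqrt_le_sqrt (hcard.trans hP)).trans ?_
    exact sqrt_le_mul_sqrt (by norm_num) (by norm_num) hℓ0.le
  have hsqQ : Real.sqrt ((2 * (9 * ℓ₁ + ℓ₁ + 1)) ^ 3) ≤ 104 * ℓ₁ * s := by
    refine (Real.sqrt_le_sqrt hQ).trans ?_
    exact sqrt_le_mul_sqrt (by norm_num) (by norm_num) hℓ0.le
  have hsqcard0 : 0 ≤ Real.sqrt card := Real.sqrt_nonneg _
  have hsqQ0 : 0 ≤ Real.sqrt ((2 * (9 * ℓ₁ + ℓ₁ + 1)) ^ 3) := Real.sqrt_nonneg _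
  -- the near-datum bracket `𝔅 ≤ C·rX·K/ℓ²`
  set K : ℝ := 27 * cd ^ 2 + 3 * sN * (26 * α + 484 * α ^ 2 + 66 * cd * α) with hK
  have hK0 : 0 ≤ K := by rw [hK]; positivity
  have h𝔅 : (C * (9 * 3 * cd ^ 2 / ℓ₁ ^ 2) * rX + sN * nX * (3 * Bt)) * ℓ₁ ^ 2 ≤ C * rX * K := by
    have e : (C * (9 * 3 * cd ^ 2 / ℓ₁ ^ 2) * rX + sN * nX * (3 * Bt)) * ℓ₁ ^ 2 = 27 * cd ^ 2 * C * rX + 3 * sN * nX * (Bt * ℓ₁ ^ 2) := by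
      field_simp
      ring
    rw [e, hK]
    have hG0 : 0 ≤ (26 * α + 484 * α ^ 2 + 66 * cd * α) * C := by positivity
    have a1 : 3 * sN * nX * (Bt * ℓ₁ ^ 2) ≤ 3 * sN * nX * ((26 * α + 484 * α ^ 2 + 66 * cd * α) * C) := mul_le_mul_of_nonneg_left hBt (by positivity)
    have a2 : 3 * sN * nX * ((26 * α + 484 * α ^ 2 + 66 * cd * α) * C) ≤ 3 * sN * rX * ((26 * α + 484 * α ^ 2 + 66 * cd * α) * C) :=
      mul_le_mul_of_nonneg_right (mul_le_mul_of_nonneg_left hnX (by positivity)) hG0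
    have e2 : C * rX * (27 * cd ^ 2 + 3 * sN * (26 * α + 484 * α ^ 2 + 66 * cd * α)) = 27 * cd ^ 2 * C * rX + 3 * sN * rX * ((26 * α + 484 * α ^ 2 + 66 * cd * α) * C) := by ring
    rw [e2]
    linarith
  -- (T2)
  have hT2 : rX * (C * (9 + 192 * (9 * ℓ₁)) + (2 * (9 * ℓ₁ + 1)) ^ 3 * (C / ℓ₁ ^ 2)) + sN * (nX * ((2 * (9 * ℓ₁ + 1)) ^ 3 * (3 * B)))
      ≤ C * (9737 + 24000 * sN * (32 * α + 400 * α ^ 2)) * ℓ₁ * rX := by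
    have a1 : C * (9 + 192 * (9 * ℓ₁)) ≤ C * (1737 * ℓ₁) := mul_le_mul_of_nonneg_left (by linarith) hC
    have a2 : (2 * (9 * ℓ₁ + 1)) ^ 3 * (C / ℓ₁ ^ 2) ≤ 8000 * ℓ₁ * C := by
      have e : (8000 : ℝ) * ℓ₁ * C = 8000 * ℓ₁ ^ 3 * (C / ℓ₁ ^ 2) := by field_simp
      rw [e]
      exact mul_le_mul_of_nonneg_right hP (by positivity)
    have a3 : (2 * (9 * ℓ₁ + 1)) ^ 3 * (3 * B) ≤ 24000 * ℓ₁ * ((32 * α + 400 * α ^ 2) * C) := by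
      have e : (2 * (9 * ℓ₁ + 1)) ^ 3 * (3 * B) ≤ 8000 * ℓ₁ ^ 3 * (3 * B) := mul_le_mul_of_nonneg_right hP (by positivity)
      have e2 : 8000 * ℓ₁ ^ 3 * (3 * B) = 24000 * ℓ₁ * (B * ℓ₁ ^ 2) := by ring
      have e3 : 24000 * ℓ₁ * (B * ℓ₁ ^ 2) ≤ 24000 * ℓ₁ * ((32 * α + 400 * α ^ 2) * C) := mul_le_mul_of_nonneg_left hB (by positivity)
      linarith
    have a4 : sN * (nX * ((2 * (9 * ℓ₁ + 1)) ^ 3 * (3 * B))) ≤ sN * (rX * (24000 * ℓ₁ * ((32 * α + 400 * α ^ 2) * C))) := by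
      refine mul_le_mul_of_nonneg_left ?_ hsN0
      exact mul_le_mul hnX a3 (by positivity) hrX
    have a5 : rX * (C * (9 + 192 * (9 * ℓ₁)) + (2 * (9 * ℓ₁ + 1)) ^ 3 * (C / ℓ₁ ^ 2)) ≤ rX * (C * (1737 * ℓ₁) + 8000 * ℓ₁ * C) :=
      mul_le_mul_of_nonneg_left (add_le_add a1 a2) hrX
    calc _ ≤ rX * (C * (1737 * ℓ₁) + 8000 * ℓ₁ * C) + sN * (rX * (24000 * ℓ₁ * ((32 * α + 400 * α ^ 2) * C))) := add_le_add a5 a4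
      _ = _ := by ring
  -- (T3)
  have hT3 : (2 * (9 * ℓ₁ + ℓ₁ + 1)) ^ 3 * (C * (9 * 3 * cd ^ 2 / ℓ₁ ^ 2) * rX + sN * nX * (3 * Bt)) ≤ 10648 * (C * rX * K) * ℓ₁ := by
    have a1 : (2 * (9 * ℓ₁ + ℓ₁ + 1)) ^ 3 * (C * (9 * 3 * cd ^ 2 / ℓ₁ ^ 2) * rX + sN * nX * (3 * Bt))
        ≤ 10648 * ℓ₁ ^ 3 * (C * (9 * 3 * cd ^ 2 / ℓ₁ ^ 2) * rX + sN * nX * (3 * Bt)) := mul_le_mul_of_nonneg_right hQ (by positivity)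
    have e : 10648 * ℓ₁ ^ 3 * (C * (9 * 3 * cd ^ 2 / ℓ₁ ^ 2) * rX + sN * nX * (3 * Bt))
        = 10648 * ℓ₁ * ((C * (9 * 3 * cd ^ 2 / ℓ₁ ^ 2) * rX + sN * nX * (3 * Bt)) * ℓ₁ ^ 2) := by ring
    rw [e] at a1
    have a2 : 10648 * ℓ₁ * ((C * (9 * 3 * cd ^ 2 / ℓ₁ ^ 2) * rX + sN * nX * (3 * Bt)) * ℓ₁ ^ 2) ≤ 10648 * ℓ₁ * (C * rX * K) := mul_le_mul_of_nonneg_left h𝔅 (by positivity)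
    calc _ ≤ 10648 * ℓ₁ * (C * rX * K) := a1.trans a2
      _ = _ := by ring
  -- (W₀·3·T4)
  have hT4 : W₀ * (3 * (Ω * Real.sqrt ((2 * (9 * ℓ₁ + ℓ₁ + 1)) ^ 3) * (C * (9 * 3 * cd ^ 2 / ℓ₁ ^ 2) * rX + sN * nX * (3 * Bt))))
      ≤ 312 * w * Ω * (C * rX * K) * ℓ₁ := by
    have a1 := weight_count_mul_le hW₀ hw hℓ0.le hs0 hΩ hsqQ0 hsqQ (by positivity : (0 : ℝ) ≤ C * (9 * 3 * cd ^ 2 / ℓ₁ ^ 2) * rX + sN * nX * (3 * Bt)) hss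
    have a2 : w * 104 * Ω * ℓ₁ * ((C * (9 * 3 * cd ^ 2 / ℓ₁ ^ 2) * rX + sN * nX * (3 * Bt)) * ℓ₁ ^ 2) ≤ w * 104 * Ω * ℓ₁ * (C * rX * K) :=
      mul_le_mul_of_nonneg_left h𝔅 (by positivity)
    have e : W₀ * (3 * (Ω * Real.sqrt ((2 * (9 * ℓ₁ + ℓ₁ + 1)) ^ 3) * (C * (9 * 3 * cd ^ 2 / ℓ₁ ^ 2) * rX + sN * nX * (3 * Bt))))
        = 3 * (W₀ * (Ω * Real.sqrt ((2 * (9 * ℓ₁ + ℓ₁ + 1)) ^ 3) * (C * (9 * 3 * cd ^ 2 / ℓ₁ ^ 2) * rX + sN * nX * (3 * Bt)))) := by ring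
    rw [e]
    calc _ ≤ 3 * (w * 104 * Ω * ℓ₁ * (C * rX * K)) := by linarith
      _ = _ := by ring
  -- (W₀·3·TH)
  have hTH : W₀ * (3 * (Ω * Real.sqrt card * (sN * (3 * B * nX) + C / ℓ₁ ^ 2 * rX)))
      ≤ 270 * w * Ω * (C * (3 * sN * (32 * α + 400 * α ^ 2) + 1)) * ℓ₁ * rX := by
    have hin : (sN * (3 * B * nX) + C / ℓ₁ ^ 2 * rX) * ℓ₁ ^ 2 ≤ C * rX * (3 * sN * (32 * α + 400 * α ^ 2) + 1) := by
      have e : (sN * (3 * B * nX) + C / ℓ₁ ^ 2 * rX) * ℓ₁ ^ 2 = 3 * sN * nX * (B * ℓ₁ ^ 2) + C * rX := by field_simp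
      rw [e]
      have a1 : 3 * sN * nX * (B * ℓ₁ ^ 2) ≤ 3 * sN * nX * ((32 * α + 400 * α ^ 2) * C) := mul_le_mul_of_nonneg_left hB (by positivity)
      have hG0 : 0 ≤ (32 * α + 400 * α ^ 2) * C := by positivity
      have a2 : 3 * sN * nX * ((32 * α + 400 * α ^ 2) * C) ≤ 3 * sN * rX * ((32 * α + 400 * α ^ 2) * C) :=
        mul_le_mul_of_nonneg_right (mul_le_mul_of_nonneg_left hnX (by positivity)) hG0
      have e2 : C * rX * (3 * sN * (32 * α + 400 * α ^ 2) + 1) = 3 * sN * rX * ((32 * α + 400 * α ^ 2) * C) + C * rX := by ring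
      rw [e2]
      linarith
    have a1 := weight_count_mul_le hW₀ hw hℓ0.le hs0 hΩ hsqcard0 hsqcard (by positivity : (0 : ℝ) ≤ sN * (3 * B * nX) + C / ℓ₁ ^ 2 * rX) hss
    have a2 : w * 90 * Ω * ℓ₁ * ((sN * (3 * B * nX) + C / ℓ₁ ^ 2 * rX) * ℓ₁ ^ 2) ≤ w * 90 * Ω * ℓ₁ * (C * rX * (3 * sN * (32 * α + 400 * α ^ 2) + 1)) :=
      mul_le_mul_of_nonneg_left hin (by positivity)
    have e : W₀ * (3 * (Ω * Real.sqrt card * (sN * (3 * B * nX) + C / ℓ₁ ^ 2 * rX))) = 3 * (W₀ * (Ω * Real.sqrt card * (sN * (3 * B * nX) + C / ℓ₁ ^ 2 * rX))) := by ring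
    rw [e]
    calc _ ≤ 3 * (w * 90 * Ω * ℓ₁ * (C * rX * (3 * sN * (32 * α + 400 * α ^ 2) + 1))) := by linarith
      _ = _ := by ring
  -- (W₀·5A·TS)
  have hTS : W₀ * (5 * A * (Ω * Real.sqrt card * (C / ℓ₁ ^ 4 * rX))) ≤ 450 * w * cA * Ω * C * ℓ₁ * rX := by
    have a1 := weight_count_mul_le hW₀ hw hℓ0.le hs0 hΩ hsqcard0 hsqcard (by positivity : (0 : ℝ) ≤ C / ℓ₁ ^ 4 * rX) hss
    have hZ : C / ℓ₁ ^ 4 * rX * ℓ₁ ^ 2 = C * rX / ℓ₁ ^ 2 := by field_simp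
    rw [hZ] at a1
    have a2 : A * (w * 90 * Ω * ℓ₁ * (C * rX / ℓ₁ ^ 2)) ≤ (cA * ℓ₁ ^ 2) * (w * 90 * Ω * ℓ₁ * (C * rX / ℓ₁ ^ 2)) := mul_le_mul_of_nonneg_right hA (by positivity)
    have e2 : (cA * ℓ₁ ^ 2) * (w * 90 * Ω * ℓ₁ * (C * rX / ℓ₁ ^ 2)) = 90 * w * cA * Ω * C * ℓ₁ * rX := by field_simp
    have e : W₀ * (5 * A * (Ω * Real.sqrt card * (C / ℓ₁ ^ 4 * rX))) = 5 * (A * (W₀ * (Ω * Real.sqrt card * (C / ℓ₁ ^ 4 * rX)))) := by ring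
    rw [e]
    have a3 : A * (W₀ * (Ω * Real.sqrt card * (C / ℓ₁ ^ 4 * rX))) ≤ A * (w * 90 * Ω * ℓ₁ * (C * rX / ℓ₁ ^ 2)) := mul_le_mul_of_nonneg_left a1 hA0
    calc _ ≤ 5 * ((cA * ℓ₁ ^ 2) * (w * 90 * Ω * ℓ₁ * (C * rX / ℓ₁ ^ 2))) := by linarith
      _ = _ := by rw [e2]; ring
  -- assemble
  have e1 : W₀ * (3 * (Ω * Real.sqrt card * (sN * (3 * B * nX) + C / ℓ₁ ^ 2 * rX)) + 5 * A * (Ω * Real.sqrt card * (C / ℓ₁ ^ 4 * rX)))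
      = W₀ * (3 * (Ω * Real.sqrt card * (sN * (3 * B * nX) + C / ℓ₁ ^ 2 * rX))) + W₀ * (5 * A * (Ω * Real.sqrt card * (C / ℓ₁ ^ 4 * rX))) := by ring
  rw [e1]
  have hfin : C * (9737 + 24000 * sN * (32 * α + 400 * α ^ 2)) * ℓ₁ * rX + 10648 * (C * rX * K) * ℓ₁ + 312 * w * Ω * (C * rX * K) * ℓ₁
      + 270 * w * Ω * (C * (3 * sN * (32 * α + 400 * α ^ 2) + 1)) * ℓ₁ * rX + 450 * w * cA * Ω * C * ℓ₁ * rX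
      = C * (9737 + 24000 * sN * (32 * α + 400 * α ^ 2) + (10648 + 312 * w * Ω) * K + 270 * w * Ω * (3 * sN * (32 * α + 400 * α ^ 2) + 1) + 450 * w * cA * Ω) * ℓ₁ * rX := by
    ring
  linarith [hT2, hT3, hT4, hTH, hTS]

end Summit.QuantumFields.YangMills.Theorems.Prop7TransplantGen0Arithmetic

end
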